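import Summits.MatrixMultiplication.OmegaCensus.SmallFormats.MatMul22nRankGF5ThreeNPlusThreeCore
import HarnessLib

/-!
# ω-census family (a): the X-cap system over `𝔽₅` at general slack `s` and the slack-generic core of the kernel replay

Cell `pub-omega` (unit `pub-omega-tensor-g8`), topic `Summits/MatrixMultiplication/OmegaCensus` (sub-folder `SmallFormats`).
Framing (verbatim): lottery ticket; floor = certified bounds/negative ranges. HONEST FRAMING: glue only. The slack-`s` system
`xcapSys5s s` has the SAME columns as `xcapSys5` (`MatMul22nRankGF5XCapSystem`: 157 class-count variables, 344 cap rows = perps of the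
dual-type / `𝔽₂₅`-type planes, 6 row-plane rows, 148 WLOG rows) and right-hand sides `s / 2s / 0` instead of `2 / 4 / 0`, so every
dictionary lemma of the slack-2 chain (`xcapSys5_A_eq'`, `rowCoef5_eq_mem'`, `rowCoef5_sym'`, …) applies verbatim. The core lemma
`card_lt_of_cert_slack` is `card_le_52_of_cert` (`MatMul22nRankGF5ThreeNPlusThreeCore`) with `2 ↦ s`, `53 ↦ T`: a passing `BoxCert`
certificate for `xcapSys5s s` with target `T` and box `[0, s]` bounds every WLOG-normalised computation of `⟨2,2,n⟩` over `𝔽₅` with at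
most `3n + s` products by `|ι| < T`. Consumers: the slack-3 certificate (`R_𝔽₅(⟨2,2,n⟩) ≥ 3n + 4` for `n ≥ 27`). Nothing here is progress on `ω`.
-/

namespace Summit.MatrixMultiplication.OmegaCensus.SmallFormats

open Module Matrix Finset Literature.Computability.AlgebraicComplexity
open Summit.MatrixMultiplication.OmegaCensus.RankOnePlaneCapGeneral

/-- Right-hand sides at slack `s`: cap rows `s`, row-plane rows `2s`, WLOG rows `0`. -/
def rhs5s (s : ℕ) (r : ℕ) : ℤ := if r < 344 then (s : ℤ) else if r < 350 then 2 * (s : ℤ) else 0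

/-- The slack-`s` X-cap system over `𝔽₅` (columns of `xcapSys5`). -/
def xcapSys5s (s : ℕ) : BoxCert.System := ⟨157, 498, col5, rhs5s s⟩

/-- Same coefficient matrix as `xcapSys5`. -/
theorem xcapSys5s_A (s r j : ℕ) : (xcapSys5s s).A r j = xcapSys5.A r j := rfl

/-- Column well-formedness (inherited from `col5`). -/
theorem xcapSys5s_colWF (s : ℕ) : (xcapSys5s s).ColWF := fun j e he => xcapSys5_colWF j e he

/-- At slack `2` this is `xcapSys5` itself. -/
theorem xcapSys5s_two : xcapSys5s 2 = xcapSys5 := by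
  have h : rhs5s 2 = rhs5 := by
    funext r; simp only [rhs5s, rhs5]; push_cast; split_ifs <;> rfl
  simp only [xcapSys5s, xcapSys5, h]

variable {ι : Type*} [Fintype ι] [DecidableEq ι]

/-- **Slack-generic core of the kernel replay.** If some certificate passes for `xcapSys5s s` (denominator `D`, target `T`, box
`[0, s]`), then every computation of `⟨2,2,n⟩` over `𝔽₅` with `|ι| ≤ 3n + s` products whose X-form class counts satisfy the WLOG rows
has `|ι| < T`. -/
theorem card_lt_of_cert_slack {s D T : ℕ} (c : BoxCert.Cert) (hc : c.check (xcapSys5s s) D T s [] = true)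
    {n : ℕ} (hι : Fintype.card ι ≤ 3 * n + s)
    (β : BilinComp (mulBilin (ZMod 5) 2 2 n) ι) (u : ι → Fin 2 × Fin 2 → ZMod 5) (hA : ∀ i x, β.f i x = dotX (u i) x)
    (hW : ∀ ρ, 350 ≤ ρ → ρ < 498 → xcount5 u (symVar5 ρ) ≤ xcount5 u (symPivot5 ρ)) :
    Fintype.card ι < T := by
  classical
  set x : ℕ → ℕ := fun j => xcount5 u j with hx
  -- box
  have hcap : ∀ ρ < 344, (univ.filter fun t => rowMem5 ρ (xvar5 (u t)) = true).card ≤ s := by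
    intro ρ hρ; have := card_rowMem5_cap_le β u hA hρ; omega
  have hbox : ∀ j, x j ≤ s := by
    intro j
    by_cases hj : j < 157
    · -- a capped row containing `j`
      obtain ⟨ρ, hρ, hmem⟩ : ∃ ρ < 344, rowMem5 ρ j = true := by
        by_cases hj' : j < 156
        · exact ⟨_, (first5_ok' hj').1, (first5_ok' hj').2⟩
        · have : j = 156 := by omega
          subst this
          exact ⟨0, by norm_num, rowMem5_z' (by norm_num)⟩
      refine le_trans ?_ (hcap ρ hρ)
      refine Finset.card_le_card fun t ht => ?_
      simp only [mem_filter, mem_univ, true_and] at ht ⊢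
      rw [ht]; exact hmem
    · have : x j = 0 := by
        simp only [hx, xcount5, Finset.card_eq_zero, Finset.filter_eq_empty_iff]
        intro t _ ht
        have := xvar5_lt (u t); omega
      omega
  -- feasibility
  have hfeas : (xcapSys5s s).Feasible x := by
    intro ρ hρ
    change ρ < 498 at hρ
    show ∑ j ∈ range 157, (xcapSys5s s).A ρ j * (x j : ℤ) ≤ rhs5s s ρ
    have eA : ∀ j ∈ range 157, (xcapSys5s s).A ρ j * (x j : ℤ) = rowCoef5 ρ j * (x j : ℤ) := by
      intro j hj
      rw [xcapSys5s_A, xcapSys5_A_eq' hρ (mem_range.1 hj)]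
    rw [sum_congr rfl eA]
    by_cases h350 : ρ < 350
    · have eM : ∀ j ∈ range 157, rowCoef5 ρ j * (x j : ℤ) = (if rowMem5 ρ j then (1 : ℤ) else 0) * (xcount5 u j : ℤ) := by
        intro j hj
        rw [rowCoef5_eq_mem' h350 (mem_range.1 hj)]
      rw [sum_congr rfl eM, sum_rowMem5_xcount5]
      by_cases h344 : ρ < 344
      · have h1 := hcap ρ h344
        have : rhs5s s ρ = s := by simp [rhs5s, h344]
        rw [this]; exact_mod_cast h1
      · obtain ⟨i, hi⟩ : ∃ i : Fin 6, ρ = 344 + i.val := ⟨⟨ρ - 344, by omega⟩, by simp; omega⟩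
        have h1 := card_rowMem5_row_le β u hA i
        have : rhs5s s ρ = 2 * (s : ℤ) := by simp [rhs5s, h344, h350]
        rw [this, hi]
        have h2 : (univ.filter fun t => rowMem5 (344 + i.val) (xvar5 (u t)) = true).card ≤ 2 * s := by omega
        exact_mod_cast h2
    · have h350' : 350 ≤ ρ := not_lt.1 h350
      have eS : ∀ j ∈ range 157, rowCoef5 ρ j * (x j : ℤ)
          = (if j = symVar5 ρ then (x j : ℤ) else 0) - (if j = symPivot5 ρ then (x j : ℤ) else 0) := by
        intro j hj
        rw [rowCoef5_sym' hρ h350' (mem_range.1 hj)]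
        split_ifs <;> simp
      rw [sum_congr rfl eS, sum_sub_distrib, sum_ite_eq' (range 157), sum_ite_eq' (range 157)]
      have hs := symVar5_lt' hρ h350'
      have hsv : symVar5 ρ ∈ range 157 := mem_range.2 (by omega)
      have hpv : symPivot5 ρ ∈ range 157 := mem_range.2 (by unfold symPivot5; split_ifs <;> norm_num)
      rw [if_pos hsv, if_pos hpv]
      have : rhs5s s ρ = 0 := by simp [rhs5s]; omega
      rw [this]
      have hw' : (xcount5 u (symVar5 ρ) : ℤ) ≤ (xcount5 u (symPivot5 ρ) : ℤ) := by exact_mod_cast hW ρ h350' hρ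
      simp only [hx]
      linarith
  -- the certificate
  have hlt := BoxCert.Cert.sum_lt_of_check_root (xcapSys5s s) (xcapSys5s_colWF s) c hc x hbox hfeas
  change ∑ j ∈ range 157, xcount5 u j < T at hlt
  rw [sum_xcount5] at hlt
  exact hlt

end Summit.MatrixMultiplication.OmegaCensus.SmallFormats
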